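import Summits.BirchSwinnertonDyer.BirchSwinnertonDyer.Theorems.RamifiedHeegnerPairLeafSigmaStarTightData
import Summits.BirchSwinnertonDyer.Rank1Residual.X11b.RingClassFieldNoTorsion
import Summits.BirchSwinnertonDyer.Rank1Residual.X11b.RingClassFieldNoTorsionOfIrreducible
import Summits.BirchSwinnertonDyer.Rank1Residual.X11b.SplitPrimeUnramified
import HarnessLib

/-!
# Disproof of `LeafSigmaStarDivisibilityAtThreeOptimalOffRows` (Σ★″) — findings of the standing disprover
# (cdisprove-stmt-BirchSwinnertonDyer-27493 g0; crux item stmt-BirchSwinnertonDyer-27493, route `RamifiedHeegnerPair`)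

BSD is not proved or disproved for any curve by anything in this file. Σ★″ itself is NOT attacked
(remit: Σ★″ is BSD₃-implied on the `ρ̄_{E,3}`-onto rows — `RamifiedPairUpperBound.pDiv_of_bsdp_of_partner_bsdp_rankOne`,
p625182 — so a counterexample to Σ★″ there is a counterexample to BSD₃). What this file does is the
LOAD-BEARING analysis of Σ★″'s clauses and the refutation of its natural STRENGTHENINGS, in the kernel
where the tree allows, as reasoning in docstrings where it does not.

FINDINGS (kernel unless marked "doc"):
* §1 `SigmaStarUpTo B` — Σ★″ with the budget `ord₃ ∏c_ℓ(E) + v₃|c|` replaced by an arbitrary budget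
  `B W c` (`c = Dt.c`); `leafSigmaStar_iff_sigmaStarUpTo_budget : Σ★″ ↔ SigmaStarUpTo budget` (`Iff.rfl`).
* §2 THE BUDGET CLAUSE IS LOAD-BEARING (`_false_without_budget`): `SigmaStarNoBudget` (the clause
  `s' ≤ …` deleted) is false at EVERY frame — at `n = 1` it says `P_1 = y_K ∈ 3^{s'} E(K[1])` for all
  `s'`, impossible for a non-torsion point of the finitely generated `E(K[1])`
  (`exists_not_pDiv_one_of_frame`, `not_sigmaStarNoBudget_of_frame`; Shimura reciprocity at
  conductor 1 and Darmon Thm. 3.6 by name; frame existence = hypothesis `FrameNonempty`, print-grade).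
* §3 TIGHTNESS AT `n = 1` (McCallum Lemma 5.1 in index language): on a `ρ̄_{E,3}`-onto frame,
  `PDiv d₁ 3 s' ↔ s' ≤ ord₃ [E(K) : ℤP]` (`pDiv_one_iff_le_padicValNat_index`). Hence
  (a) the `n = 1` layer of Σ★″ IS the inequality `ord₃ ∏c_ℓ + v₃|c| ≤ ord₃ [E(K):ℤ y_K]`
  (`budget_le_padicValNat_index_of_leafSigmaStar`) — the Tamagawa–Manin divisibility of the Heegner
  index, BSD-predicted, open at an additive `3`;
  (b) `SigmaStarUpTo B` is false as soon as ONE onto frame has `ord₃ [E(K):ℤP] < B W c`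
  (`not_sigmaStarUpTo_of_frame_index_lt`); in particular the STRENGTHENING BY ONE
  (`B = budget + 1`, the lead's «PDiv d 3 (T + v₃ c + 1) at n = 1») is false modulo the named per-row
  hypothesis `ord₃ [E(K):ℤP] ≤ ord₃ ∏c_ℓ + v₃|c|` (`not_pDiv_one_succ_of_padicValNat_index_le`,
  `not_sigmaStarUpTo_budget_succ_of_frame`), and that hypothesis follows from `BSD₃(E) ∧ BSD₃(E^{d_K})`
  and `3 ∤ #Ш(E/K)` (`padicValNat_index_le_budget_of_bsdp_pair_of_not_dvd_sha`; exact form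
  `pDiv_one_iff_of_bsdp_pair`: under the two BSD₃'s, `PDiv d₁ 3 s' ↔ 2 s' ≤ ord₃ #Ш(E/K) + 2 ord₃∏c_ℓ + 2 v₃|c|`).
  So: the budget cannot be raised by one on any onto row whose `Ш(E/K)[3] = 0` — BSD-reading: every
  row of the census with `3 ∤ #Ш_an(E)·#Ш_an(E^{d_K})`; unconditional per row once the exact Heegner
  index coefficient is computed (engine `HOME/bsd-wall-census/qp1/heeg2.gp`, QP1-E1-HEEGNER-INDEX-PROTO-v1;
  KIT ASK filed «to director-bsd», kit not allowed in this seat). ANSWERED 2026-08-30T09:56Z by desk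
  trib-w-rhp g20, `TIGHTNESS-HEEG2-PROBE500.md` (evidence on this item; kit j339660, 0.47 core-h, 28-digit
  CM-point evaluation, NOT a kernel certificate): on the four `ρ̄₃`-onto leaf rows
  `142956q1 (d_K = −167)`, `252252bo1 (−887)`, `198900n1 (−191)`, `282240gd1 (−311)` (each with two
  Tamagawa-`3` carriers, `ord₃ ∏c_p(E/ℚ) = 2`, optimal curve so `v₃|c| = 0`, `E(K)_tors = 1`,
  `Ш_an(E) · Ш_an(E^d) ∈ {1, 4}`) the exact Heegner index has `ord₃ [E(K) : ℤ y_K] = 2 = budget`.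
  So on each of these rows the per-row hypothesis `ord₃ [E(K):ℤP] ≤ budget` of
  `not_pDiv_one_succ_of_padicValNat_index_le` / `not_sigmaStarUpTo_budget_succ_of_frame` is met
  NUMERICALLY: «budget + 1» (`s' = 3` at `n = 1`: `27 ∣ y_K`) FAILS there, while Σ★″'s own `n = 1` layer
  (`9 ∣ y_K`) holds WITH EQUALITY — the budget is attained, print-grade, on 4/4 probed rows (consistent
  with the desk's PREREG-SIGMA-MOD9 «Σ★⁸ CONSISTENT at s′ = 2», 21 pairs, RESULTS 989346b85b905e72).
* §3c ROW-WISE SHARPNESS (`budget_succ_false_at_row_of_bsdp_pair_of_h56`): under `BSD₃(E) ∧ BSD₃(E^{d_K})`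
  AND McCallum's Cor. 5.6 at the datum (`h56`, the labelled hypothesis of the tree's
  `indexLowerBoundAt_of_kolyvaginCertificate`), the row's «budget + 1» conclusion is FALSE ON EVERY onto
  row, whatever `Ш(E/K)[3^∞]` is: the `n = 1` certificate makes `M_∞ ≤ M₀ < ∞`, «budget + 1» forces
  `M_∞ ≥ budget + 1`, `h56` + the two BSD₃'s force `M_∞ = budget`. With TightData (Σ★″ ⟸ BSD₃-pair +
  print) this pins the exact threshold: `M_∞ = ord₃∏c_ℓ + v₃|c|` on every onto row — Σ★″ is SHARP.
* §4 (doc + small kernel remarks) the other clauses: `Odd d_K`, lattice-optimality, the off-rows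
  exclusion, `Addv`/`SubGss` are NOT where a counterexample can come from (TightData needs none of
  them: BSD₃-pair ⟹ Σ on any globally minimal non-CM tower-onto `E` with `3 ∣ N`; they are PROOF
  artefacts of the U-lines); `¬ IsOfFinAddOrder P` dropped = Kolyvagin's conjecture territory in
  `K`-rank ≥ 3 (open at `3`, no witness); the index guard `s' ≤ M(ℓ)` dropped = `P_n` only defined
  modulo `3^{M(n)} E(K[n])` (Gross 1991 Prop. 3.6) — expected false at (row `T ≥ 2`, `ℓ` with
  `M(ℓ) = 1`), NO kernel witness (obstruction recorded in `SigmaStarNoIndexGuard`'s docstring).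
* TORSION WINDOW (no image binder in Σ★″): empty — `SubGss` forces `ρ̄₃` irreducible (Serre Prop. 12 +
  twist), see §4; irreducible-row forms of §3 proved (`pDiv_one_iff_le_padicValNat_index_of_irreducible`,
  `not_pDiv_one_succ_of_padicValNat_index_le_of_irreducible`,
  `leafSigmaStar_budget_succ_false_of_irreducible_frame_index_le`).
* `-- Targets`: none served (no line picked on 27493; the U₁ lead's stuck stub Σ★⁸ is Σ★″ plus a
  top-layer hypothesis and inherits §2–§3 verbatim).

## HANDOFF
landed (proposed g0) under `Theorems/LeafSigmaStarDivisibilityAtThreeOptimalOffRows/Negative/`: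
`BudgetLoadBearing.lean` (p766049: §2, `leafSigmaStar_false_without_budget`) and `IndexThreshold.lean`
(p766359: §3 + §3b, `pDiv_one_iff_le_padicValNat_index[_of_noTorsion]`,
`not_pDiv_one_succ_of_padicValNat_index_le`, `budget_le_padicValNat_index_of_leafSigmaStar`,
`leafSigmaStar_budget_succ_false_of_frame_index_le`, `padicValNat_index_le_budget_of_bsdp_pair_of_not_dvd_sha`,
`pDiv_one_iff_of_bsdp_pair`), namespace `…Theorems.LeafSigmaStarDivisibilityAtThreeOptimalOffRowsNegative`,
statements INLINED (no defs); sorried here: nothing; next regimes: (i) per-row exact Heegner index on 2–3 onto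
leaf rows (KIT ASK) to make §3(b) unconditional at a named frame; (ii) a kernel witness for the
index-guard clause needs the Euler-system congruence `P_ℓ ≡ (ℓ+1)… − a_ℓ …` reduced at `λ ∣ ℓ` with
`E(𝔽_λ)[3^∞]` cyclic-by-cyclic of DIFFERENT exponents (choose `ℓ` with `9 ∣ ℓ+1+a_ℓ`, `3 ∥ ℓ+1−a_ℓ`).
-/

-- D-0017: single-problem summit, so `Summit.BirchSwinnertonDyer.BirchSwinnertonDyer.…` repeats a namespace BY DESIGN.
set_option linter.dupNamespace false
set_option autoImplicit false

noncomputable section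

open scoped Classical NumberField

open WeierstrassCurve NumberField IsDedekindDomain Literature Literature.NumberTheory.EllipticCurves
  Literature.NumberTheory.EllipticCurves.ModularForms
  Literature.NumberTheory.EllipticCurves.Rank1Residual
  Literature.NumberTheory.EllipticCurves.Rank1Residual.Typed
  Summit.BirchSwinnertonDyer.Rank1Residual
  Summit.BirchSwinnertonDyer.Rank1Residual.Additive
  Summit.BirchSwinnertonDyer.Rank1Residual.X11b
  Summit.BirchSwinnertonDyer.BirchSwinnertonDyer.Theses.RamifiedHeegnerPair
  Summit.BirchSwinnertonDyer.BirchSwinnertonDyer.Theorems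

namespace Summit.BirchSwinnertonDyer.BirchSwinnertonDyer.Cruxes.LeafSigmaStarDivisibilityAtThreeOptimalOffRows.Disproof

/-! ## §1 Σ★″ with a parametrised budget -/

/-- **Σ★″ with budget `B`.** The registered text of `LeafSigmaStarDivisibilityAtThreeOptimalOffRows`
VERBATIM, except that the bound `s' ≤ padicValNat 3 W.tamagawaProduct + padicValNat 3 Dt.c.natAbs` is
replaced by `s' ≤ B W Dt.c` for an arbitrary budget function `B` of the curve and the lattice scalar. `B = budget` is Σ★″ itself
(`leafSigmaStar_iff_sigmaStarUpTo_budget`), `B = budget + 1` is the strengthening by one,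
`∀ B` is the budget-free statement (`sigmaStarNoBudget_iff`). A predicate; nothing asserted. [folklore] -/
def SigmaStarUpTo (B : WeierstrassCurve ℚ → ℤ → ℕ) : Prop :=
  ∀ (W : WeierstrassCurve ℚ) [W.IsElliptic] [W.IsGloballyMinimal] (N : ℕ) [NeZero N] (K : Type) [Field K]
    [NumberField K] (Dt : ModularParametrizationData W N) (H : HeegnerDatum N (NumberField.discr K)) (ι : K →+* ℂ)
    (P : (W.baseChange K).toAffine.Point), ¬ W.HasCM → Addv W 3 → SubGss W 3 → W.conductorNorm ℤ = N →
    (∀ z ∈ Dt.L.lattice, ∃ w ∈ periodLattice Dt.f, z = Dt.c * w) →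
    ¬ ((∃ (q : ℕ) (_ : Fact q.Prime), q ∣ N ∧ ¬ q ^ 2 ∣ N ∧
          padicValNat 3 W.tamagawaProduct ≤ padicValNat 3 ((W.baseChange ℚ_[q]).localTamagawaNumber ℤ_[q])) ∧
        (∀ (q' : ℕ) [Fact q'.Prime], q' ∣ N → 3 ∣ (W.baseChange ℚ_[q']).localTamagawaNumber ℤ_[q'] → ¬ q' ^ 2 ∣ N)) →
    IsImaginaryQuadratic K → SatisfiesHeegnerHypothesis N K →
    (WeierstrassCurve.Affine.Point.map ι.toRatAlgHom) P = heegnerPointComplex Dt H → ¬ IsOfFinAddOrder P →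
    Odd (NumberField.discr K) → ∀ (s' : ℕ), s' ≤ B W Dt.c →
    ∀ (n : ℕ) (d : KolyvaginHeegnerData Dt H.β ι n), Squarefree n →
    (∀ ℓ ∈ n.primeFactors, Zhang2014.IsKolyvaginPrime N W K 3 ℓ ∧ s' ≤ Zhang2014.kolyvaginIndex W 3 ℓ) →
    Three.Koly.PDiv d 3 s'

/-- The registered budget of Σ★″: `ord₃ ∏_ℓ c_ℓ(E) + v₃ |c(Dt)|`. [folklore] -/
def budget (W : WeierstrassCurve ℚ) (c : ℤ) : ℕ :=
  padicValNat 3 W.tamagawaProduct + padicValNat 3 c.natAbs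

/-- **Σ★″ is `SigmaStarUpTo budget`, definitionally.** [folklore] -/
theorem leafSigmaStar_iff_sigmaStarUpTo_budget :
    LeafSigmaStarDivisibilityAtThreeOptimalOffRows ↔ SigmaStarUpTo budget :=
  Iff.rfl

/-- **Σ★″ WITHOUT the budget clause** (the clause `s' ≤ ord₃ ∏c_ℓ + v₃|c|` deleted, everything else
verbatim): every derived point `P_n` would be `3^{s'}`-divisible for EVERY `s'`. A predicate. [folklore] -/
def SigmaStarNoBudget : Prop :=
  ∀ (W : WeierstrassCurve ℚ) [W.IsElliptic] [W.IsGloballyMinimal] (N : ℕ) [NeZero N] (K : Type) [Field K]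
    [NumberField K] (Dt : ModularParametrizationData W N) (H : HeegnerDatum N (NumberField.discr K)) (ι : K →+* ℂ)
    (P : (W.baseChange K).toAffine.Point), ¬ W.HasCM → Addv W 3 → SubGss W 3 → W.conductorNorm ℤ = N →
    (∀ z ∈ Dt.L.lattice, ∃ w ∈ periodLattice Dt.f, z = Dt.c * w) →
    ¬ ((∃ (q : ℕ) (_ : Fact q.Prime), q ∣ N ∧ ¬ q ^ 2 ∣ N ∧
          padicValNat 3 W.tamagawaProduct ≤ padicValNat 3 ((W.baseChange ℚ_[q]).localTamagawaNumber ℤ_[q])) ∧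
        (∀ (q' : ℕ) [Fact q'.Prime], q' ∣ N → 3 ∣ (W.baseChange ℚ_[q']).localTamagawaNumber ℤ_[q'] → ¬ q' ^ 2 ∣ N)) →
    IsImaginaryQuadratic K → SatisfiesHeegnerHypothesis N K →
    (WeierstrassCurve.Affine.Point.map ι.toRatAlgHom) P = heegnerPointComplex Dt H → ¬ IsOfFinAddOrder P →
    Odd (NumberField.discr K) → ∀ (s' : ℕ),
    ∀ (n : ℕ) (d : KolyvaginHeegnerData Dt H.β ι n), Squarefree n →
    (∀ ℓ ∈ n.primeFactors, Zhang2014.IsKolyvaginPrime N W K 3 ℓ ∧ s' ≤ Zhang2014.kolyvaginIndex W 3 ℓ) →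
    Three.Koly.PDiv d 3 s'

/-- Budget-free = every budget. [folklore] -/
theorem sigmaStarNoBudget_iff : SigmaStarNoBudget ↔ ∀ B, SigmaStarUpTo B := by
  constructor
  · intro h B W _ _ N _ K _ _ Dt H ι P hCM hAddv hGss hN hOpt hOff hK hHN hP hPinf hodd s' _ n d hn hℓ
    exact h W N K Dt H ι P hCM hAddv hGss hN hOpt hOff hK hHN hP hPinf hodd s' n d hn hℓ
  · intro h W _ _ N _ K _ _ Dt H ι P hCM hAddv hGss hN hOpt hOff hK hHN hP hPinf hodd s' n d hn hℓ
    exact h (fun _ _ ↦ s') W N K Dt H ι P hCM hAddv hGss hN hOpt hOff hK hHN hP hPinf hodd s' le_rfl n d hn hℓ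

/-- Monotonicity in the budget: a larger budget is a stronger statement. [folklore] -/
theorem sigmaStarUpTo_mono {B B' : WeierstrassCurve ℚ → ℤ → ℕ}
    (hBB' : ∀ (W : WeierstrassCurve ℚ) (c : ℤ), B W c ≤ B' W c)
    (h : SigmaStarUpTo B') : SigmaStarUpTo B := by
  intro W _ _ N _ K _ _ Dt H ι P hCM hAddv hGss hN hOpt hOff hK hHN hP hPinf hodd s' hs' n d hn hℓ
  exact h W N K Dt H ι P hCM hAddv hGss hN hOpt hOff hK hHN hP hPinf hodd s' (hs'.trans (hBB' W Dt.c)) n d hn hℓ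

/-! ## §2 The budget clause is load-bearing: no derived point `P_1 = y_K` is infinitely `3`-divisible -/

section Frame

-- `K : Type`: the tree's ring-class class field theory is universe `0`.
variable {K : Type} [Field K] [NumberField K]
variable {N : ℕ} [NeZero N] {W : WeierstrassCurve ℚ} [W.IsElliptic] {Dt : ModularParametrizationData W N} {β : ℤ}
  {ι : K →+* ℂ}

/-- **A non-torsion `P_1` is not `3^{s'}`-divisible in `E(K[1])` for some `s'`.** `K[1]` is a number
field (`finiteDimensional_and_isGalois_ringClassField`, `NumberField.of_module_finite`), so `E(K[1])` is finitely generated (Mordell–Weil,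
`module_finite_point_holds`) and a non-torsion element has a maximal `3`-power divisor
(`exists_pow_smul_eq_and_forall_ne`, McCallum Lemma 5.1's `M₀ < ∞`). No image hypothesis, no
parity, no budget. [cite: McCallumLMS1991, §5 Lemma 5.1 (p. 303)] -/
theorem exists_not_pDiv_one (hK : IsImaginaryQuadratic K) (d₁ : KolyvaginHeegnerData Dt β ι 1)
    (h : ¬ IsOfFinAddOrder d₁.derivedPoint) : ∃ s' : ℕ, ¬ Three.Koly.PDiv d₁ 3 s' := by
  haveI := (finiteDimensional_and_isGalois_ringClassField hK ι one_ne_zero).1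
  haveI : NumberField (ringClassField K ι 1) := NumberField.of_module_finite K _
  haveI : Module.Finite ℤ (W.baseChange (ringClassField K ι 1)).toAffine.Point := by
    convert (W.baseChange (ringClassField K ι 1)).module_finite_point_holds
  obtain ⟨M₀, -, -, hmax⟩ := exists_pow_smul_eq_and_forall_ne h (p := 3) (by norm_num)
  exact ⟨M₀ + 1, fun ⟨Q, hQ⟩ ↦ hmax Q (by rw [← natCast_zsmul]; exact hQ)⟩

/-- **At a Heegner frame, `P_1` is not infinitely `3`-divisible.** For `P ∈ E(K)` non-torsion with
complex point `heegnerPointComplex Dt H` under `ι` and ANY Kolyvagin–Heegner datum `d₁` of conductor `1`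
on `(Dt, H.β, ι)`: `P_1 = d₁.derivedPoint` is the image of `P` (Shimura reciprocity at conductor `1`,
`hrec`, named fact NOT discharged; tree `KolyvaginBottom.isOfFinAddOrder_derivedPoint_one_iff`), hence
non-torsion, hence `∃ s', ¬ 3^{s'} ∣ P_1`. CONDITIONAL on `hrec`. [cite: GrossLMS1991, §4 (P_1 = y_K)]
[cite: McCallumLMS1991, §5 Lemma 5.1 (p. 303)] -/
theorem exists_not_pDiv_one_of_frame (hrec : heegnerPointOfConductor_one_galoisConj N W K)
    (hK : IsImaginaryQuadratic K) (hHN : SatisfiesHeegnerHypothesis N K) {H : HeegnerDatum N (NumberField.discr K)}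
    {P : (W.baseChange K).toAffine.Point}
    (hP : WeierstrassCurve.Affine.Point.map (W' := W) ι.toRatAlgHom P = heegnerPointComplex Dt H)
    (hPinf : ¬ IsOfFinAddOrder P) (d₁ : KolyvaginHeegnerData Dt H.β ι 1) :
    ∃ s' : ℕ, ¬ Three.Koly.PDiv d₁ 3 s' :=
  exists_not_pDiv_one hK d₁ fun h ↦
    hPinf ((KolyvaginBottom.isOfFinAddOrder_derivedPoint_one_iff hrec hK hHN hP d₁ rfl).mp h)

end Frame

/-- **A Σ★″-frame exists** (the hypothesis `H` of the class-level negative lemmas of §2): some globally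
minimal non-CM leaf curve (`Addv ∧ SubGss` at `3`) of conductor `N` with a lattice-optimal datum off the
mono-carrier rows, an odd Heegner field `K`, and a NON-TORSION Heegner point `P ∈ E(K)` on the frame
`(Dt, H, ι)`. Print-grade (every one of the 355 residual `r_an = 1` leaf classes of the census, e.g.
`133956n1`, `142956q1`, with a Heegner `d_K` of `L(E^{d_K},1) ≠ 0`: Gross–Zagier + modularity +
Mazur's Manin bound give such a frame); NOT constructed in the tree (conductor, Tamagawa numbers,
`analyticRank` and the Heegner point of a concrete curve are not kernel-computable here). A predicate;
nothing asserted. [cite: GrossZagier1986, Thm. I.(6.3)] -/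
def FrameNonempty : Prop :=
  ∃ (W : WeierstrassCurve ℚ) (_ : W.IsElliptic) (_ : W.IsGloballyMinimal) (N : ℕ) (_ : NeZero N) (K : Type)
    (_ : Field K) (_ : NumberField K) (Dt : ModularParametrizationData W N) (H : HeegnerDatum N (NumberField.discr K))
    (ι : K →+* ℂ) (P : (W.baseChange K).toAffine.Point),
    ¬ W.HasCM ∧ Addv W 3 ∧ SubGss W 3 ∧ W.conductorNorm ℤ = N ∧
    (∀ z ∈ Dt.L.lattice, ∃ w ∈ periodLattice Dt.f, z = Dt.c * w) ∧
    ¬ ((∃ (q : ℕ) (_ : Fact q.Prime), q ∣ N ∧ ¬ q ^ 2 ∣ N ∧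
          padicValNat 3 W.tamagawaProduct ≤ padicValNat 3 ((W.baseChange ℚ_[q]).localTamagawaNumber ℤ_[q])) ∧
        (∀ (q' : ℕ) [Fact q'.Prime], q' ∣ N → 3 ∣ (W.baseChange ℚ_[q']).localTamagawaNumber ℤ_[q'] → ¬ q' ^ 2 ∣ N)) ∧
    IsImaginaryQuadratic K ∧ SatisfiesHeegnerHypothesis N K ∧
    (WeierstrassCurve.Affine.Point.map ι.toRatAlgHom) P = heegnerPointComplex Dt H ∧ ¬ IsOfFinAddOrder P ∧
    Odd (NumberField.discr K)

/-- **`Σ★″_false_without_budget`: the budget clause is load-bearing.** Given Shimura reciprocity at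
conductor `1` (`hrec`) and Darmon's Thm. 3.6 (`h36`, which supplies a Kolyvagin–Heegner datum of
conductor `1` on every frame, tree `nonempty_kolyvaginHeegnerData_one_of_darmon36`) as named facts, and
ONE Σ★″-frame (`FrameNonempty`, print-grade hypothesis), the budget-free statement `SigmaStarNoBudget`
is FALSE: at `n = 1` (square-free, no prime factors — the Kolyvagin guard is vacuous) it asserts
`3^{s'} ∣ P_1` for every `s'`, contradicting `exists_not_pDiv_one_of_frame`. Any proof of Σ★″ must
therefore USE the bound `s' ≤ ord₃ ∏c_ℓ + v₃|c|` (where exactly the threshold lies: §3).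
CONDITIONAL on `hrec`, `h36`, `FrameNonempty`. [cite: McCallumLMS1991, §5 Lemma 5.1 (p. 303)]
[cite: Darmon2004, Thm. 3.6 and §3.7 (PDF pp. 44, 49)] -/
theorem not_sigmaStarNoBudget_of_frame
    (hrec : ∀ (N : ℕ) [NeZero N] (W : WeierstrassCurve ℚ) (K : Type) [Field K] [NumberField K],
      heegnerPointOfConductor_one_galoisConj N W K)
    (h36 : ∀ (N : ℕ) [NeZero N] (W : WeierstrassCurve ℚ) (K : Type) [Field K] [NumberField K],
      phi_heegnerTau_mem_range_map_singularModuliField N W K)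
    (hF : FrameNonempty) : ¬ SigmaStarNoBudget := by
  intro hS
  obtain ⟨W, _, _, N, _, K, _, _, Dt, H, ι, P, hCM, hAddv, hGss, hN, hOpt, hOff, hK, hHN, hP, hPinf, hodd⟩ := hF
  obtain ⟨d₁⟩ := nonempty_kolyvaginHeegnerData_one_of_darmon36 (h36 _ W K) hK Dt H.β ι H.dvd_sq_sub
  obtain ⟨s', hs'⟩ := exists_not_pDiv_one_of_frame (hrec _ W K) hK hHN hP hPinf d₁
  exact hs' (hS W N K Dt H ι P hCM hAddv hGss hN hOpt hOff hK hHN hP hPinf hodd s' 1 d₁ squarefree_one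
    (fun ℓ hℓ ↦ absurd hℓ (by simp)))

/-- Pointwise form without the frame-existence hypothesis: `SigmaStarNoBudget` and the named facts give,
at EVERY Σ★″-frame, `3^{s'} ∣ P_1` for all `s'` — which `exists_not_pDiv_one_of_frame` forbids. Stated as
the implication `SigmaStarNoBudget → ¬ FrameNonempty` (no frame can exist), the contrapositive reading of
`not_sigmaStarNoBudget_of_frame`. CONDITIONAL on `hrec`, `h36`. [folklore] -/
theorem not_frameNonempty_of_sigmaStarNoBudget
    (hrec : ∀ (N : ℕ) [NeZero N] (W : WeierstrassCurve ℚ) (K : Type) [Field K] [NumberField K],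
      heegnerPointOfConductor_one_galoisConj N W K)
    (h36 : ∀ (N : ℕ) [NeZero N] (W : WeierstrassCurve ℚ) (K : Type) [Field K] [NumberField K],
      phi_heegnerTau_mem_range_map_singularModuliField N W K)
    (hS : SigmaStarNoBudget) : ¬ FrameNonempty :=
  fun hF ↦ not_sigmaStarNoBudget_of_frame hrec h36 hF hS

/-! ## §3 Tightness at `n = 1`: McCallum's Lemma 5.1 in index language, and the strengthening by one -/

section Tight

variable {K : Type} [Field K] [NumberField K]
variable {N : ℕ} [NeZero N] {W : WeierstrassCurve ℚ} [W.IsElliptic] {Dt : ModularParametrizationData W N} {β : ℤ}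
  {ι : K →+* ℂ}

/-- **`3^{s'} ∣ P` in `E(K)` iff `s' ≤ M₀`**, where `3^{M₀} ∥ P` (`hx₀`, `hmax`). Pure group theory.
[cite: McCallumLMS1991, §5 Lemma 5.1 (p. 303), M₀] -/
theorem exists_zsmul_eq_iff_le {A : Type*} [AddCommGroup A] {P x₀ : A} {M₀ : ℕ} (hx₀ : 3 ^ M₀ • x₀ = P)
    (hmax : ∀ Q : A, 3 ^ (M₀ + 1) • Q ≠ P) (s' : ℕ) :
    (∃ Q : A, ((3 ^ s' : ℕ) : ℤ) • Q = P) ↔ s' ≤ M₀ := by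
  constructor
  · rintro ⟨Q, hQ⟩
    by_contra hlt
    obtain ⟨e, rfl⟩ : ∃ e, s' = M₀ + 1 + e := ⟨s' - (M₀ + 1), by omega⟩
    refine hmax (3 ^ e • Q) ?_
    rw [natCast_zsmul] at hQ
    rw [← mul_nsmul', ← pow_add]
    exact hQ
  · intro hle
    obtain ⟨e, rfl⟩ : ∃ e, M₀ = s' + e := ⟨M₀ - s', by omega⟩
    refine ⟨3 ^ e • x₀, ?_⟩
    rw [natCast_zsmul, ← mul_nsmul', ← pow_add]
    exact hx₀

/-- **McCallum's Lemma 5.1 at `n = 1`, index form, IMAGE-FREE: `3^{s'} ∣ P_1` in `E(K[1])` iff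
`s' ≤ ord₃ [E(K) : ℤP]`.** Hypotheses: `K` imaginary quadratic; `E(K)[3] = 0` (`hiv`) and `E(K[1])` has
no `3`-power torsion (`htor`) — both supplied by `ρ̄_{E,3}` onto (`pDiv_one_iff_le_padicValNat_index`), and
on the non-onto leaf rows by irreducibility + Weil pairing + `3` unramified in `K`
(`torsionBy_pow_ringClassField_eq_bot_of_hasIrreducibleModPGaloisRep`); `rank E(K) = 1`; `P ∈ E(K)`
non-torsion mapping to `P_1 = d₁.derivedPoint`. Then `PDiv d₁ 3 s'` ⟺ `3^{s'} ∣ P` in `E(K)` (Galois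
descent, tree `Three.Koly.pDiv_one_iff_exists_zsmul_eq`) ⟺ `s' ≤ M₀` (`3^{M₀} ∥ P`) ⟺ `s' ≤ ord₃ [E(K):ℤP]`
(`padicValNat_index_zmultiples_eq_of_divisibility`). So the `n = 1` layer of any Σ-form statement is
EXACTLY a lower bound on the `3`-adic Heegner index. Unconditional given the displayed hypotheses.
[cite: McCallumLMS1991, §5 Lemma 5.1 (p. 303) and its proof (p. 304)] [cite: GrossLMS1991, Lemma 4.3] -/
theorem pDiv_one_iff_le_padicValNat_index_of_noTorsion (hK : IsImaginaryQuadratic K)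
    (hiv : ∀ x : (W.baseChange K).toAffine.Point, (3 : ℕ) • x = 0 → x = 0)
    (htor : ∀ (M : ℕ) (R : (W.baseChange (ringClassField K ι 1)).toAffine.Point), ((3 ^ M : ℕ) : ℤ) • R = 0 → R = 0)
    (hrank : (W.baseChange K).mordellWeilRank = 1) (d₁ : KolyvaginHeegnerData Dt β ι 1)
    (P : (W.baseChange K).toAffine.Point)
    (hP1 : WeierstrassCurve.Affine.Point.map (W' := W) (algebraMap K (ringClassField K ι 1)).toRatAlgHom P =
      d₁.derivedPoint)
    (hPinf : ¬ IsOfFinAddOrder P) (s' : ℕ) :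
    Three.Koly.PDiv d₁ 3 s' ↔ s' ≤ padicValNat 3 (AddSubgroup.zmultiples P).index := by
  -- `3^{M₀} ∥ P` in `E(K)` and `ord₃ [E(K):ℤP] = M₀`
  haveI : Module.Finite ℤ (W.baseChange K).toAffine.Point := (W.baseChange K).module_finite_point_holds
  obtain ⟨M₀, x₀, hx₀, hmax⟩ := exists_pow_smul_eq_and_forall_ne hPinf (p := 3) Nat.prime_three.two_le
  have hdiv : ∃ Q : (W.baseChange K).toAffine.Point, ((3 ^ M₀ : ℕ) : ℤ) • Q = P :=
    ⟨x₀, by rw [natCast_zsmul]; exact hx₀⟩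
  have hndiv : ¬ ∃ Q : (W.baseChange K).toAffine.Point, ((3 ^ (M₀ + 1) : ℕ) : ℤ) • Q = P := by
    rintro ⟨Q, hQ⟩
    exact hmax Q (by rw [← natCast_zsmul]; exact hQ)
  haveI : Finite (AddCommGroup.torsion (W.baseChange K).toAffine.Point) :=
    WeierstrassCurve.finite_torsion_point (W := W.baseChange K)
  obtain ⟨c, Q, hcQ, hcker⟩ := RankOne.exists_coord_of_mordellWeilRank_eq_one (W.baseChange K) hrank
  have hidx : padicValNat 3 (AddSubgroup.zmultiples P).index = M₀ :=
    Three.Koly.padicValNat_index_zmultiples_eq_of_divisibility c Q hcQ hcker hiv P hdiv hndiv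
  -- Galois descent
  rw [Three.Koly.pDiv_one_iff_exists_zsmul_eq hK d₁ P hP1 3 s' (htor s'), hidx]
  exact exists_zsmul_eq_iff_le hx₀ hmax s'

/-- **McCallum's Lemma 5.1 at `n = 1`, index form, on a `ρ̄_{E,3}`-onto row:** `PDiv d₁ 3 s' ↔
s' ≤ ord₃ [E(K):ℤP]`. `ρ̄_{E,3}` onto gives `E(K)[3] = 0`
(`torsionBy_eq_bot_of_isImaginaryQuadratic_of_hasIrreducibleModPGaloisRep`) and no `3`-power torsion in
`E(K[1])` (Gross Lemma 4.3, tree `RingClassNoTorsion.eq_zero_of_zsmul_pow_eq_zero_ringClassField`).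
[cite: McCallumLMS1991, §5 Lemma 5.1 (p. 303)] [cite: GrossLMS1991, Lemma 4.3] -/
theorem pDiv_one_iff_le_padicValNat_index (hK : IsImaginaryQuadratic K) (hsurj3 : W.HasSurjectiveModNGaloisRep 3)
    (hrank : (W.baseChange K).mordellWeilRank = 1) (d₁ : KolyvaginHeegnerData Dt β ι 1)
    (P : (W.baseChange K).toAffine.Point)
    (hP1 : WeierstrassCurve.Affine.Point.map (W' := W) (algebraMap K (ringClassField K ι 1)).toRatAlgHom P =
      d₁.derivedPoint)
    (hPinf : ¬ IsOfFinAddOrder P) (s' : ℕ) :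
    Three.Koly.PDiv d₁ 3 s' ↔ s' ≤ padicValNat 3 (AddSubgroup.zmultiples P).index := by
  have hp2 : (3 : ℕ) ≠ 2 := by decide
  have hirr : W.HasIrreducibleModPGaloisRep 3 := hasIrreducibleModPGaloisRep_of_hasSurjectiveModNGaloisRep W 3 hsurj3
  -- `E(K)[3] = 0`
  have hbot := torsionBy_eq_bot_of_isImaginaryQuadratic_of_hasIrreducibleModPGaloisRep W K hK Nat.prime_three hirr
  have hiv : ∀ x : (W.baseChange K).toAffine.Point, (3 : ℕ) • x = 0 → x = 0 := fun x hx ↦ by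
    have hmem : x ∈ AddSubgroup.torsionBy (W.baseChange K).toAffine.Point (((3 : ℕ) : ℕ) : ℤ) := by
      rw [mem_torsionBy_iff, natCast_zsmul]
      exact hx
    rw [hbot] at hmem
    exact hmem
  exact pDiv_one_iff_le_padicValNat_index_of_noTorsion hK hiv
    (fun M R hR ↦ RingClassNoTorsion.eq_zero_of_zsmul_pow_eq_zero_ringClassField W hK ι one_ne_zero Nat.prime_three
      hp2 hsurj3 M R hR) hrank d₁ P hP1 hPinf s'

/-- **The strengthening by one fails at `n = 1` modulo the per-row index hypothesis** (the lead's
`disprover-wanted`, rhp-p2 g52): if `ord₃ [E(K):ℤP] ≤ B` then `¬ 3^{B+1} ∣ P_1`, i.e.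
`¬ PDiv d₁ 3 (B + 1)`; with `B = ord₃ ∏c_ℓ(E) + v₃|c|` this is `¬ PDiv d₁ 3 (T + v₃ c + 1)`. The
hypothesis is the `3`-part of the Gross–Zagier/BSD index identity on a row with `Ш(E/K)[3] = 0`
(`padicValNat_index_le_budget_of_bsdp_pair_of_not_dvd_sha`) and is an EXACT per-pair computation
(index coefficient `n′` of `2y_K = n′Q′ + T`, engine `heeg2.gp` of QP1-E1-HEEGNER-INDEX-PROTO-v1).
[cite: McCallumLMS1991, §5 Lemma 5.1 (p. 303)] -/
theorem not_pDiv_one_succ_of_padicValNat_index_le (hK : IsImaginaryQuadratic K)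
    (hsurj3 : W.HasSurjectiveModNGaloisRep 3) (hrank : (W.baseChange K).mordellWeilRank = 1)
    (d₁ : KolyvaginHeegnerData Dt β ι 1) (P : (W.baseChange K).toAffine.Point)
    (hP1 : WeierstrassCurve.Affine.Point.map (W' := W) (algebraMap K (ringClassField K ι 1)).toRatAlgHom P =
      d₁.derivedPoint)
    (hPinf : ¬ IsOfFinAddOrder P) {B : ℕ} (hidx : padicValNat 3 (AddSubgroup.zmultiples P).index ≤ B) :
    ¬ Three.Koly.PDiv d₁ 3 (B + 1) := by
  rw [pDiv_one_iff_le_padicValNat_index hK hsurj3 hrank d₁ P hP1 hPinf]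
  omega

/-- **McCallum's Lemma 5.1 at `n = 1`, index form, on an IRREDUCIBLE row (all Σ★″ rows: `SubGss`
makes `E` a ramified quadratic twist of a good-supersingular-at-`3` curve, whose `ρ̄₃` is irreducible
already on inertia — Serre 1972 Prop. 12; the 98 non-onto leaf classes are normaliser-of-non-split-Cartan
rows).** `E(K)[3] = 0` from irreducibility
(`torsionBy_eq_bot_of_isImaginaryQuadratic_of_hasIrreducibleModPGaloisRep`); no `3`-power torsion in
`E(K[1])` from irreducibility + the Weil pairing (`hW`, named) + `3` unramified in `K`, which the Heegner
hypothesis at `3 ∣ N` gives (`3` splits: `isUnramifiedIn_of_ncard_primesOver_eq_two`) — tree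
`torsionBy_pow_ringClassField_eq_bot_of_hasIrreducibleModPGaloisRep`. Then
`PDiv d₁ 3 s' ↔ s' ≤ ord₃ [E(K):ℤP]`. [cite: McCallumLMS1991, §5 Lemma 5.1 (p. 303), §4 (5)]
[cite: GrossLMS1991, Lemma 4.3] [cite: Serre1972, §1.11 Prop. 12] -/
theorem pDiv_one_iff_le_padicValNat_index_of_irreducible (hK : IsImaginaryQuadratic K)
    (hHN : SatisfiesHeegnerHypothesis N K) (h3N : 3 ∣ N) (hirr : W.HasIrreducibleModPGaloisRep 3)
    (hW : W.exists_weilPairing 3) (hrank : (W.baseChange K).mordellWeilRank = 1)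
    (d₁ : KolyvaginHeegnerData Dt β ι 1) (P : (W.baseChange K).toAffine.Point)
    (hP1 : WeierstrassCurve.Affine.Point.map (W' := W) (algebraMap K (ringClassField K ι 1)).toRatAlgHom P =
      d₁.derivedPoint)
    (hPinf : ¬ IsOfFinAddOrder P) (s' : ℕ) :
    Three.Koly.PDiv d₁ 3 s' ↔ s' ≤ padicValNat 3 (AddSubgroup.zmultiples P).index := by
  haveI : Fact (Nat.Prime 3) := ⟨Nat.prime_three⟩
  have hp2 : (3 : ℕ) ≠ 2 := by decide
  -- `E(K)[3] = 0`
  have hbot := torsionBy_eq_bot_of_isImaginaryQuadratic_of_hasIrreducibleModPGaloisRep W K hK Nat.prime_three hirr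
  have hiv : ∀ x : (W.baseChange K).toAffine.Point, (3 : ℕ) • x = 0 → x = 0 := fun x hx ↦ by
    have hmem : x ∈ AddSubgroup.torsionBy (W.baseChange K).toAffine.Point (((3 : ℕ) : ℕ) : ℤ) := by
      rw [mem_torsionBy_iff, natCast_zsmul]
      exact hx
    rw [hbot] at hmem
    exact hmem
  -- `3` unramified in `K` (it splits, Heegner hypothesis at `3 ∣ N`)
  have hKunr : ∀ v : HeightOneSpectrum (𝓞 ℚ), ((3 : ℕ) : 𝓞 ℚ) ∈ v.asIdeal →
      Algebra.IsUnramifiedIn (𝓞 K) v.asIdeal :=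
    isUnramifiedIn_of_ncard_primesOver_eq_two hK.1 Nat.prime_three (hHN 3 Nat.prime_three h3N)
  -- no `3^M`-torsion in `E(K[1])`
  have htor : ∀ (M : ℕ) (R : (W.baseChange (ringClassField K ι 1)).toAffine.Point),
      ((3 ^ M : ℕ) : ℤ) • R = 0 → R = 0 := fun M R hR ↦ by
    have hmem : R ∈ AddSubgroup.torsionBy (W.baseChange (ringClassField K ι 1)).toAffine.Point ((3 ^ M : ℕ) : ℤ) := by
      rw [mem_torsionBy_iff]
      exact hR
    rw [NoTorsionIrr.torsionBy_pow_ringClassField_eq_bot_of_hasIrreducibleModPGaloisRep W hK ι one_ne_zero Nat.prime_three hp2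
      hirr hW hKunr (by decide) M] at hmem
    exact hmem
  exact pDiv_one_iff_le_padicValNat_index_of_noTorsion hK hiv htor hrank d₁ P hP1 hPinf s'

/-- **Strengthening by one fails at `n = 1` on an IRREDUCIBLE row, modulo the per-row index hypothesis**
(`ord₃ [E(K):ℤP] ≤ B ⟹ ¬ 3^{B+1} ∣ P_1`). [cite: McCallumLMS1991, §5 Lemma 5.1 (p. 303)] -/
theorem not_pDiv_one_succ_of_padicValNat_index_le_of_irreducible (hK : IsImaginaryQuadratic K)
    (hHN : SatisfiesHeegnerHypothesis N K) (h3N : 3 ∣ N) (hirr : W.HasIrreducibleModPGaloisRep 3)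
    (hW : W.exists_weilPairing 3) (hrank : (W.baseChange K).mordellWeilRank = 1)
    (d₁ : KolyvaginHeegnerData Dt β ι 1) (P : (W.baseChange K).toAffine.Point)
    (hP1 : WeierstrassCurve.Affine.Point.map (W' := W) (algebraMap K (ringClassField K ι 1)).toRatAlgHom P =
      d₁.derivedPoint)
    (hPinf : ¬ IsOfFinAddOrder P) {B : ℕ} (hidx : padicValNat 3 (AddSubgroup.zmultiples P).index ≤ B) :
    ¬ Three.Koly.PDiv d₁ 3 (B + 1) := by
  rw [pDiv_one_iff_le_padicValNat_index_of_irreducible hK hHN h3N hirr hW hrank d₁ P hP1 hPinf]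
  omega

/-- **From the frame binders of Σ★″ to the descent binders.** At a Σ★″-frame with `P` non-torsion,
Shimura reciprocity (`hrec`) identifies `P_1` with the image of `P` in `E(K[1])`
(`heegnerSystem_exists_isHeegnerPoint_map_eq_derivedPoint_one` + `eq_of_map_eq_heegnerPointComplex`), and
Kolyvagin's theorem (`hKo`, named) gives `rank E(K) = 1`. CONDITIONAL on `hrec`, `hKo`. [folklore] -/
theorem map_eq_derivedPoint_and_rank_of_frame [W.IsGloballyMinimal]
    (hrec : heegnerPointOfConductor_one_galoisConj N W K) (hKo : kolyvagin N W K)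
    (hK : IsImaginaryQuadratic K) (hHN : SatisfiesHeegnerHypothesis N K) {H : HeegnerDatum N (NumberField.discr K)}
    {P : (W.baseChange K).toAffine.Point}
    (hP : WeierstrassCurve.Affine.Point.map (W' := W) ι.toRatAlgHom P = heegnerPointComplex Dt H)
    (hPinf : ¬ IsOfFinAddOrder P) (d₁ : KolyvaginHeegnerData Dt H.β ι 1) :
    WeierstrassCurve.Affine.Point.map (W' := W) (algebraMap K (ringClassField K ι 1)).toRatAlgHom P =
        d₁.derivedPoint ∧ (W.baseChange K).mordellWeilRank = 1 := by
  obtain ⟨P₀, -, hP₀⟩ := heegnerSystem_exists_isHeegnerPoint_map_eq_derivedPoint_one hrec hK hHN d₁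
  obtain rfl : P₀ = P := KolyvaginBottom.eq_of_map_eq_heegnerPointComplex hrec hK hHN d₁ rfl hP hP₀
  exact ⟨hP₀, (hKo hK hHN ⟨Dt, H, ι, hP⟩ hPinf).1⟩

/-- **The `n = 1` content of Σ★″ is the Tamagawa–Manin divisibility of the Heegner index.** If Σ★″
holds then at every Σ★″-frame whose curve has `ρ̄_{E,3}` onto and for which a conductor-`1` datum exists
(Darmon Thm. 3.6, `h36`): `ord₃ ∏c_ℓ(E) + v₃|c| ≤ ord₃ [E(K) : ℤ y_K]`. (Take `s' =` budget, `n = 1`.)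
This inequality is the UPPER half of the `3`-part of the Gross–Zagier–BSD index identity with the
`Ш`-term dropped; it follows from `BSD₃(E) ∧ BSD₃(E^{d_K})` (SOED `indexBounds_of_bsdp_of_partner_bsdp`,
upper component) and is not known otherwise at an additive `3` (Jetchev 2008 Thm. 1.1 proves the
analogous index divisibility only for `p ∤ N`). A necessary condition, not a refutation.
CONDITIONAL on `hrec`, `hKo`, `h36`. [cite: McCallumLMS1991, §5 Lemma 5.1 (p. 303)]
[cite: Jetchev2008, Thm. 1.1 and Conj. 1.3] [cite: GrossZagier1986, V.(2.2)] -/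
theorem budget_le_padicValNat_index_of_leafSigmaStar (hS : LeafSigmaStarDivisibilityAtThreeOptimalOffRows)
    (hrec : ∀ (N : ℕ) [NeZero N] (W : WeierstrassCurve ℚ) (K : Type) [Field K] [NumberField K],
      heegnerPointOfConductor_one_galoisConj N W K)
    (hKo : ∀ (N : ℕ) [NeZero N] (W : WeierstrassCurve ℚ) (K : Type) [Field K] [NumberField K],
      kolyvagin N W K)
    (h36 : ∀ (N : ℕ) [NeZero N] (W : WeierstrassCurve ℚ) (K : Type) [Field K] [NumberField K],
      phi_heegnerTau_mem_range_map_singularModuliField N W K)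
    (W : WeierstrassCurve ℚ) [W.IsElliptic] [W.IsGloballyMinimal] (N : ℕ) [NeZero N]
    (K : Type) [Field K] [NumberField K]
    (Dt : ModularParametrizationData W N) (H : HeegnerDatum N (NumberField.discr K)) (ι : K →+* ℂ)
    (P : (W.baseChange K).toAffine.Point)
    (hCM : ¬ W.HasCM) (hAddv : Addv W 3) (hGss : SubGss W 3) (hN : W.conductorNorm ℤ = N)
    (hOpt : ∀ z ∈ Dt.L.lattice, ∃ w ∈ periodLattice Dt.f, z = Dt.c * w)
    (hOff : ¬ ((∃ (q : ℕ) (_ : Fact q.Prime), q ∣ N ∧ ¬ q ^ 2 ∣ N ∧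
          padicValNat 3 W.tamagawaProduct ≤ padicValNat 3 ((W.baseChange ℚ_[q]).localTamagawaNumber ℤ_[q])) ∧
        (∀ (q' : ℕ) [Fact q'.Prime], q' ∣ N → 3 ∣ (W.baseChange ℚ_[q']).localTamagawaNumber ℤ_[q'] → ¬ q' ^ 2 ∣ N)))
    (hK : IsImaginaryQuadratic K) (hHN : SatisfiesHeegnerHypothesis N K)
    (hP : WeierstrassCurve.Affine.Point.map ι.toRatAlgHom P = heegnerPointComplex Dt H)
    (hPinf : ¬ IsOfFinAddOrder P) (hodd : Odd (NumberField.discr K))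
    (hsurj3 : W.HasSurjectiveModNGaloisRep 3) :
    budget W Dt.c ≤ padicValNat 3 (AddSubgroup.zmultiples P).index := by
  obtain ⟨d₁⟩ := nonempty_kolyvaginHeegnerData_one_of_darmon36 (h36 _ W K) hK Dt H.β ι H.dvd_sq_sub
  obtain ⟨hP1, hrank⟩ := map_eq_derivedPoint_and_rank_of_frame (hrec _ W K) (hKo _ W K) hK hHN hP hPinf d₁
  have h := hS W N K Dt H ι P hCM hAddv hGss hN hOpt hOff hK hHN hP hPinf hodd (budget W Dt.c) le_rfl 1 d₁
    squarefree_one (fun ℓ hℓ ↦ absurd hℓ (by simp))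
  exact (pDiv_one_iff_le_padicValNat_index hK hsurj3 hrank d₁ P hP1 hPinf _).mp h

/-- **A Σ★″-frame with `ρ̄_{E,3}` onto whose `3`-adic Heegner index is below `B`** — the hypothesis `H`
of `not_sigmaStarUpTo_of_frame_index_lt`. For `B = budget + 1` this reads `ord₃ [E(K):ℤP] ≤ ord₃∏c_ℓ + v₃|c|`
on some onto row: BSD-reading = any onto row of the census with `3 ∤ #Ш_an(E)·#Ш_an(E^{d_K})`
(`padicValNat_index_le_budget_of_bsdp_pair_of_not_dvd_sha`); exactly decidable per pair by the Heegner
index engine. Print/computation-grade; NOT constructed in the tree. A predicate; nothing asserted. [folklore] -/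
def OntoFrameIndexLt (B : WeierstrassCurve ℚ → ℤ → ℕ) : Prop :=
  ∃ (W : WeierstrassCurve ℚ) (_ : W.IsElliptic) (_ : W.IsGloballyMinimal) (N : ℕ) (_ : NeZero N) (K : Type)
    (_ : Field K) (_ : NumberField K) (Dt : ModularParametrizationData W N) (H : HeegnerDatum N (NumberField.discr K))
    (ι : K →+* ℂ) (P : (W.baseChange K).toAffine.Point),
    ¬ W.HasCM ∧ Addv W 3 ∧ SubGss W 3 ∧ W.conductorNorm ℤ = N ∧
    (∀ z ∈ Dt.L.lattice, ∃ w ∈ periodLattice Dt.f, z = Dt.c * w) ∧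
    ¬ ((∃ (q : ℕ) (_ : Fact q.Prime), q ∣ N ∧ ¬ q ^ 2 ∣ N ∧
          padicValNat 3 W.tamagawaProduct ≤ padicValNat 3 ((W.baseChange ℚ_[q]).localTamagawaNumber ℤ_[q])) ∧
        (∀ (q' : ℕ) [Fact q'.Prime], q' ∣ N → 3 ∣ (W.baseChange ℚ_[q']).localTamagawaNumber ℤ_[q'] → ¬ q' ^ 2 ∣ N)) ∧
    IsImaginaryQuadratic K ∧ SatisfiesHeegnerHypothesis N K ∧
    (WeierstrassCurve.Affine.Point.map ι.toRatAlgHom) P = heegnerPointComplex Dt H ∧ ¬ IsOfFinAddOrder P ∧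
    Odd (NumberField.discr K) ∧ W.HasSurjectiveModNGaloisRep 3 ∧
    padicValNat 3 (AddSubgroup.zmultiples P).index < B W Dt.c

/-- **Threshold theorem: `SigmaStarUpTo B` is false as soon as one onto frame has `ord₃ [E(K):ℤP] < B`.**
(`n = 1`, McCallum 5.1.) Read with `B = budget`: a counterexample to Σ★″ AT `n = 1` is exactly an onto
row with `ord₃ [E(K):ℤ y_K] < ord₃ ∏c_ℓ + v₃|c|` — which BSD₃ of the pair forbids (TightData); read with
`B = budget + 1`: `not_sigmaStarUpTo_budget_succ_of_frame`. CONDITIONAL on `hrec`, `hKo`, `h36` and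
the displayed frame hypothesis. [cite: McCallumLMS1991, §5 Lemma 5.1 (p. 303)] -/
theorem not_sigmaStarUpTo_of_frame_index_lt
    {B : WeierstrassCurve ℚ → ℤ → ℕ}
    (hrec : ∀ (N : ℕ) [NeZero N] (W : WeierstrassCurve ℚ) (K : Type) [Field K] [NumberField K],
      heegnerPointOfConductor_one_galoisConj N W K)
    (hKo : ∀ (N : ℕ) [NeZero N] (W : WeierstrassCurve ℚ) (K : Type) [Field K] [NumberField K],
      kolyvagin N W K)
    (h36 : ∀ (N : ℕ) [NeZero N] (W : WeierstrassCurve ℚ) (K : Type) [Field K] [NumberField K],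
      phi_heegnerTau_mem_range_map_singularModuliField N W K)
    (hF : OntoFrameIndexLt B) : ¬ SigmaStarUpTo B := by
  intro hS
  obtain ⟨W, _, _, N, _, K, _, _, Dt, H, ι, P, hCM, hAddv, hGss, hN, hOpt, hOff, hK, hHN, hP, hPinf, hodd, hsurj3,
    hlt⟩ := hF
  obtain ⟨d₁⟩ := nonempty_kolyvaginHeegnerData_one_of_darmon36 (h36 _ W K) hK Dt H.β ι H.dvd_sq_sub
  obtain ⟨hP1, hrank⟩ := map_eq_derivedPoint_and_rank_of_frame (hrec _ W K) (hKo _ W K) hK hHN hP hPinf d₁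
  have h := hS W N K Dt H ι P hCM hAddv hGss hN hOpt hOff hK hHN hP hPinf hodd (B W Dt.c) le_rfl 1 d₁
    squarefree_one (fun ℓ hℓ ↦ absurd hℓ (by simp))
  have := (pDiv_one_iff_le_padicValNat_index hK hsurj3 hrank d₁ P hP1 hPinf _).mp h
  omega

/-- **Refuted strengthening (modulo the per-row index hypothesis): Σ★″ with budget `+ 1` is false** as
soon as one onto Σ★″-frame has `ord₃ [E(K):ℤP] ≤ ord₃ ∏c_ℓ(E) + v₃|c|` — target (ii) of the brief
(«PDiv at `s′ = T + 1` on a row with `Ш(E/K)[3] = 0`»). CONDITIONAL on `hrec`, `hKo`, `h36`,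
`OntoFrameIndexLt (budget + 1)`. [cite: McCallumLMS1991, §5 Lemma 5.1 (p. 303)] -/
theorem not_sigmaStarUpTo_budget_succ_of_frame
    (hrec : ∀ (N : ℕ) [NeZero N] (W : WeierstrassCurve ℚ) (K : Type) [Field K] [NumberField K],
      heegnerPointOfConductor_one_galoisConj N W K)
    (hKo : ∀ (N : ℕ) [NeZero N] (W : WeierstrassCurve ℚ) (K : Type) [Field K] [NumberField K],
      kolyvagin N W K)
    (h36 : ∀ (N : ℕ) [NeZero N] (W : WeierstrassCurve ℚ) (K : Type) [Field K] [NumberField K],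
      phi_heegnerTau_mem_range_map_singularModuliField N W K)
    (hF : OntoFrameIndexLt (fun W c ↦ budget W c + 1)) :
    ¬ SigmaStarUpTo (fun W c ↦ budget W c + 1) :=
  not_sigmaStarUpTo_of_frame_index_lt hrec hKo h36 hF

/-- **Refuted strengthening on IRREDUCIBLE rows (modulo the per-row index hypothesis): Σ★″ with budget
`+ 1` is FALSE** as soon as ONE Σ★″-frame with `ρ̄_{E,3}` irreducible (all leaf rows, Serre Prop. 12),
the Weil pairing (`exists_weilPairing 3`, named) and `3 ∣ N` has `ord₃ [E(K):ℤP] ≤ ord₃ ∏c_ℓ(E) + v₃|c|`.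
The negated statement is the registered text with `padicValNat 3 Dt.c.natAbs` replaced by
`padicValNat 3 Dt.c.natAbs + 1`, everything else VERBATIM. CONDITIONAL on `hrec`, `hKo`, `h36`, `hF`;
BSD is proved or disproved for no curve. [cite: McCallumLMS1991, §5 Lemma 5.1 (p. 303), §4 (5)]
[cite: GrossLMS1991, Lemma 4.3] -/
theorem leafSigmaStar_budget_succ_false_of_irreducible_frame_index_le
    (hrec : ∀ (N : ℕ) [NeZero N] (W : WeierstrassCurve ℚ) (K : Type) [Field K] [NumberField K],
      heegnerPointOfConductor_one_galoisConj N W K)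
    (hKo : ∀ (N : ℕ) [NeZero N] (W : WeierstrassCurve ℚ) (K : Type) [Field K] [NumberField K],
      kolyvagin N W K)
    (h36 : ∀ (N : ℕ) [NeZero N] (W : WeierstrassCurve ℚ) (K : Type) [Field K] [NumberField K],
      phi_heegnerTau_mem_range_map_singularModuliField N W K)
    (hF : ∃ (W : WeierstrassCurve ℚ) (_ : W.IsElliptic) (_ : W.IsGloballyMinimal) (N : ℕ) (_ : NeZero N) (K : Type)
      (_ : Field K) (_ : NumberField K) (Dt : ModularParametrizationData W N) (H : HeegnerDatum N (NumberField.discr K))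
      (ι : K →+* ℂ) (P : (W.baseChange K).toAffine.Point),
      ¬ W.HasCM ∧ Addv W 3 ∧ SubGss W 3 ∧ W.conductorNorm ℤ = N ∧
      (∀ z ∈ Dt.L.lattice, ∃ w ∈ periodLattice Dt.f, z = Dt.c * w) ∧
      ¬ ((∃ (q : ℕ) (_ : Fact q.Prime), q ∣ N ∧ ¬ q ^ 2 ∣ N ∧
            padicValNat 3 W.tamagawaProduct ≤ padicValNat 3 ((W.baseChange ℚ_[q]).localTamagawaNumber ℤ_[q])) ∧
          (∀ (q' : ℕ) [Fact q'.Prime], q' ∣ N → 3 ∣ (W.baseChange ℚ_[q']).localTamagawaNumber ℤ_[q'] → ¬ q' ^ 2 ∣ N)) ∧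
      IsImaginaryQuadratic K ∧ SatisfiesHeegnerHypothesis N K ∧
      (WeierstrassCurve.Affine.Point.map ι.toRatAlgHom) P = heegnerPointComplex Dt H ∧ ¬ IsOfFinAddOrder P ∧
      Odd (NumberField.discr K) ∧ 3 ∣ N ∧ W.HasIrreducibleModPGaloisRep 3 ∧ W.exists_weilPairing 3 ∧
      padicValNat 3 (AddSubgroup.zmultiples P).index ≤ padicValNat 3 W.tamagawaProduct + padicValNat 3 Dt.c.natAbs) :
    ¬ (∀ (W : WeierstrassCurve ℚ) [W.IsElliptic] [W.IsGloballyMinimal] (N : ℕ) [NeZero N] (K : Type) [Field K]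
        [NumberField K] (Dt : ModularParametrizationData W N) (H : HeegnerDatum N (NumberField.discr K)) (ι : K →+* ℂ)
        (P : (W.baseChange K).toAffine.Point), ¬ W.HasCM → Addv W 3 → SubGss W 3 → W.conductorNorm ℤ = N →
        (∀ z ∈ Dt.L.lattice, ∃ w ∈ periodLattice Dt.f, z = Dt.c * w) →
        ¬ ((∃ (q : ℕ) (_ : Fact q.Prime), q ∣ N ∧ ¬ q ^ 2 ∣ N ∧
              padicValNat 3 W.tamagawaProduct ≤ padicValNat 3 ((W.baseChange ℚ_[q]).localTamagawaNumber ℤ_[q])) ∧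
            (∀ (q' : ℕ) [Fact q'.Prime], q' ∣ N → 3 ∣ (W.baseChange ℚ_[q']).localTamagawaNumber ℤ_[q'] → ¬ q' ^ 2 ∣ N)) →
        IsImaginaryQuadratic K → SatisfiesHeegnerHypothesis N K →
        (WeierstrassCurve.Affine.Point.map ι.toRatAlgHom) P = heegnerPointComplex Dt H → ¬ IsOfFinAddOrder P →
        Odd (NumberField.discr K) →
        ∀ (s' : ℕ), s' ≤ padicValNat 3 W.tamagawaProduct + (padicValNat 3 Dt.c.natAbs + 1) →
        ∀ (n : ℕ) (d : KolyvaginHeegnerData Dt H.β ι n), Squarefree n →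
        (∀ ℓ ∈ n.primeFactors, Zhang2014.IsKolyvaginPrime N W K 3 ℓ ∧ s' ≤ Zhang2014.kolyvaginIndex W 3 ℓ) →
        Three.Koly.PDiv d 3 s') := by
  intro hS
  obtain ⟨W, _, _, N, _, K, _, _, Dt, H, ι, P, hCM, hAddv, hGss, hN, hOpt, hOff, hK, hHN, hP, hPinf, hodd, h3N, hirr,
    hW, hle⟩ := hF
  obtain ⟨d₁⟩ := nonempty_kolyvaginHeegnerData_one_of_darmon36 (h36 _ W K) hK Dt H.β ι H.dvd_sq_sub
  obtain ⟨hP1, hrank⟩ := map_eq_derivedPoint_and_rank_of_frame (hrec _ W K) (hKo _ W K) hK hHN hP hPinf d₁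
  have h := hS W N K Dt H ι P hCM hAddv hGss hN hOpt hOff hK hHN hP hPinf hodd
    (padicValNat 3 W.tamagawaProduct + padicValNat 3 Dt.c.natAbs + 1) (by omega) 1 d₁ squarefree_one
    (fun ℓ hℓ ↦ absurd hℓ (by simp))
  have := (pDiv_one_iff_le_padicValNat_index_of_irreducible hK hHN h3N hirr hW hrank d₁ P hP1 hPinf _).mp h
  omega

end Tight

/-! ### §3b The per-row index hypothesis from BSD₃ of the pair (rank-one orientation) -/

section BSD

variable {K : Type} [Field K] [NumberField K]

/-- **`BSD₃(E) ∧ BSD₃(E^{d_K}) ∧ 3 ∤ #Ш(E/K) ⟹ ord₃ [E(K):ℤP] ≤ ord₃ ∏c_ℓ(E) + v₃|c|`** (rank-one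
orientation: `r_an(E) = 1`, `L(E^{d_K},1) ≠ 0`). The LOWER component of SOED's
`WildKolyvaginUpperAtThreeTight.indexBounds_of_bsdp_of_partner_bsdp` is STEP L at slack `v₃|c|`:
`2 ord₃ [E(K):ℤP] ≤ ord₃ #Ш(E/K) + 2 ord₃ ∏c_ℓ + 2 v₃|c|`; with `3 ∤ #Ш(E/K)` the `Ш`-term vanishes.
So on such a row the hypothesis of `not_pDiv_one_succ_of_padicValNat_index_le` at `B = budget` holds and the
strengthening of Σ★″ by one FAILS at `n = 1` — BSD-conditionally; nothing asserted about any curve.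
[cite: GrossZagier1986, Thm. I.(6.3) and V.(2.2)] [cite: JetchevSkinnerWan2017, §7.4.1] -/
theorem padicValNat_index_le_budget_of_bsdp_pair_of_not_dvd_sha
    (hGZ : ∀ (N : ℕ) [NeZero N] (W : WeierstrassCurve ℚ) (K : Type) [Field K] [NumberField K],
      gross_zagier N W K)
    (hKo : ∀ (N : ℕ) [NeZero N] (W : WeierstrassCurve ℚ) (K : Type) [Field K] [NumberField K],
      kolyvagin N W K)
    (hGZK : rank_eq_analyticRank_of_analyticRank_le_one) (hmod : hasEntireLFunction_rat)
    (hGZ73 : GrossZagier1986_thm_I_7_3)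
    (W : WeierstrassCurve ℚ) [W.IsElliptic] [W.IsGloballyMinimal] (N : ℕ) [NeZero N]
    (Dt : ModularParametrizationData W N) (H : HeegnerDatum N (NumberField.discr K)) (ι : K →+* ℂ)
    (P : (W.baseChange K).toAffine.Point) (Wd : WeierstrassCurve ℚ) [Wd.IsElliptic] [Wd.IsGloballyMinimal]
    (hr : W.analyticRank = 1) (hN : W.conductorNorm ℤ = N) (h3N : 3 ∣ N) (hK : IsImaginaryQuadratic K)
    (hodd : Odd (NumberField.discr K)) (hHN : SatisfiesHeegnerHypothesis N K)
    (hLt : (W.quadraticTwist (NumberField.discr K : ℚ)).entireLFunction 1 ≠ 0)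
    (hP : WeierstrassCurve.Affine.Point.map ι.toRatAlgHom P = heegnerPointComplex Dt H)
    (hC : ∃ C : VariableChange ℚ, C • W.quadraticTwist (NumberField.discr K : ℚ) = Wd)
    (hBW : BSDp W 3) (hBWd : BSDp Wd 3) (hSha : ¬ 3 ∣ (W.baseChange K).shaOrder) :
    padicValNat 3 (AddSubgroup.zmultiples P).index ≤ budget W Dt.c := by
  haveI : Fact (Nat.Prime 3) := ⟨Nat.prime_three⟩
  have hp2 : (3 : ℕ) ≠ 2 := by decide
  subst hN
  obtain ⟨-, hμ⟩ := X11b.Three.not_dvd_discr_and_not_dvd_torsionOrder_of_heegner hK hHN hp2 h3N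
  obtain ⟨hlow, -⟩ := WildKolyvaginUpperAtThreeTight.indexBounds_of_bsdp_of_partner_bsdp hGZ hKo hGZK hmod hGZ73 W 3
    (W.conductorNorm ℤ) K Dt H ι P Wd hr rfl h3N hK hodd hμ hHN hLt hP hC hp2 hBW hBWd
  unfold SchneiderFree.IndexLowerBoundLeAt at hlow
  have h0 : padicValNat 3 (W.baseChange K).shaOrder = 0 := padicValNat.eq_zero_of_not_dvd hSha
  unfold budget
  omega

/-- **Exact `n = 1` picture under BSD₃ of the pair (tower onto, rank-one orientation):**
`PDiv d₁ 3 s' ↔ 2 s' ≤ ord₃ #Ш(E/K) + 2 ord₃ ∏c_ℓ(E) + 2 v₃|c|`. Both components of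
`indexBounds_of_bsdp_of_partner_bsdp` give `2 ord₃ [E(K):ℤP] = ord₃ #Ш(E/K) + 2 ord₃∏c_ℓ + 2 v₃|c|`, and
`pDiv_one_iff_le_padicValNat_index` converts. Consequences (BSD-reading, onto rows): Σ★″ at `n = 1` asks
exactly `ord₃ #Ш(E/K) ≥ 0` — no content beyond BSD; its strengthening by one at `n = 1` holds iff
`9 ∣ #Ш(E/K)` (`Ш` has square order) — so «budget + 1» is FALSE on every onto row with `Ш(E/K)[3] = 0`
and TRUE at `n = 1` on rows with `3 ∣ #Ш(E/K)`: the registered budget is the largest ROW-UNIFORM one.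
CONDITIONAL on the named facts and the two `BSDp`'s; nothing asserted about any curve.
[cite: McCallumLMS1991, §5 Lemma 5.1 (p. 303)] [cite: GrossZagier1986, V.(2.2)] -/
theorem pDiv_one_iff_of_bsdp_pair
    (hGZ : ∀ (N : ℕ) [NeZero N] (W : WeierstrassCurve ℚ) (K : Type) [Field K] [NumberField K],
      gross_zagier N W K)
    (hKo : ∀ (N : ℕ) [NeZero N] (W : WeierstrassCurve ℚ) (K : Type) [Field K] [NumberField K],
      kolyvagin N W K)
    (hGZK : rank_eq_analyticRank_of_analyticRank_le_one) (hmod : hasEntireLFunction_rat)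
    (hGZ73 : GrossZagier1986_thm_I_7_3)
    (hrec : ∀ (N : ℕ) [NeZero N] (W : WeierstrassCurve ℚ) (K : Type) [Field K] [NumberField K],
      heegnerPointOfConductor_one_galoisConj N W K)
    (W : WeierstrassCurve ℚ) [W.IsElliptic] [W.IsGloballyMinimal] (N : ℕ) [NeZero N]
    (Dt : ModularParametrizationData W N) (H : HeegnerDatum N (NumberField.discr K)) (ι : K →+* ℂ)
    (P : (W.baseChange K).toAffine.Point) (Wd : WeierstrassCurve ℚ) [Wd.IsElliptic] [Wd.IsGloballyMinimal]
    (hr : W.analyticRank = 1) (hN : W.conductorNorm ℤ = N) (h3N : 3 ∣ N)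
    (hsurj3 : W.HasSurjectiveModNGaloisRep 3) (hK : IsImaginaryQuadratic K)
    (hodd : Odd (NumberField.discr K)) (hHN : SatisfiesHeegnerHypothesis N K)
    (hLt : (W.quadraticTwist (NumberField.discr K : ℚ)).entireLFunction 1 ≠ 0)
    (hP : WeierstrassCurve.Affine.Point.map ι.toRatAlgHom P = heegnerPointComplex Dt H)
    (hC : ∃ C : VariableChange ℚ, C • W.quadraticTwist (NumberField.discr K : ℚ) = Wd)
    (hBW : BSDp W 3) (hBWd : BSDp Wd 3) (d₁ : KolyvaginHeegnerData Dt H.β ι 1) (s' : ℕ) :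
    Three.Koly.PDiv d₁ 3 s' ↔
      2 * s' ≤ padicValNat 3 (W.baseChange K).shaOrder + 2 * padicValNat 3 W.tamagawaProduct +
        2 * padicValNat 3 Dt.c.natAbs := by
  haveI : Fact (Nat.Prime 3) := ⟨Nat.prime_three⟩
  have hp2 : (3 : ℕ) ≠ 2 := by decide
  subst hN
  obtain ⟨-, hμ⟩ := X11b.Three.not_dvd_discr_and_not_dvd_torsionOrder_of_heegner hK hHN hp2 h3N
  have hPinf : ¬ IsOfFinAddOrder P :=
    not_isOfFinAddOrder_of_heegner_of_analyticRank_eq_one W (W.conductorNorm ℤ) K Dt H ι P (hGZ _ W K) hmod hr hK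
      hHN hLt hP
  obtain ⟨hP1, hrank⟩ := map_eq_derivedPoint_and_rank_of_frame (hrec _ W K) (hKo _ W K) hK hHN hP hPinf d₁
  obtain ⟨hlow, hup⟩ := WildKolyvaginUpperAtThreeTight.indexBounds_of_bsdp_of_partner_bsdp hGZ hKo hGZK hmod hGZ73
    W 3 (W.conductorNorm ℤ) K Dt H ι P Wd hr rfl h3N hK hodd hμ hHN hLt hP hC hp2 hBW hBWd
  unfold SchneiderFree.IndexLowerBoundLeAt at hlow
  unfold SchneiderFree.Upper.IndexUpperBoundLeAt at hup
  rw [pDiv_one_iff_le_padicValNat_index hK hsurj3 hrank d₁ P hP1 hPinf]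
  omega

end BSD

/-! ## §3c Row-wise SHARPNESS of the budget: under BSD₃ of the pair and McCallum's Cor. 5.6 (`h56`)
the strengthening «budget + 1» fails on EVERY onto row — whatever `Ш(E/K)[3^∞]` is -/

section Sharp

variable {K : Type} [Field K] [NumberField K]

/-- **The registered budget is SHARP ON EVERY ROW, not only row-uniformly** (tightness lemma (b)).
At an onto Σ★″-frame in the rank-one orientation, ASSUME `BSD₃(E) ∧ BSD₃(E^{d_K})` and McCallum's
Cor. 5.6 at this datum (`h56`: `M_∞ = m ⟹ #Ш(E/K)[3^∞] = 3^{2(M₀ − m)}`, `M₀ = ord₃ [E(K):ℤP]`; the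
labelled hypothesis of the tree's `indexLowerBoundAt_of_kolyvaginCertificate`). THEN the row's
«budget + 1» conclusion — `3^{s'} ∣ P_n` for all `s' ≤ ord₃∏c_ℓ + v₃|c| + 1` and all `n ∈ S(s')` — is
FALSE. Proof: the `n = 1` certificate `3^{M₀+1} ∤ P_1` (McCallum 5.1, unconditional) gives
`M_∞ ≤ M₀ < ∞`; «budget + 1» kills every certificate of level `≤ budget + 1`, so `M_∞ ≥ budget + 1`
(`iInf_lt_iff` on the tree's `Minf`/`Mr`/`divOrd`); `h56` gives `ord₃ #Ш = 2(M₀ − M_∞) ≤ 2(M₀ − budget − 1)`,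
while the two BSD₃'s give `ord₃ #Ш = 2(M₀ − budget)` (`indexBounds_of_bsdp_of_partner_bsdp`, both
components) — contradiction. So with `h56` the deeper layers see what `n = 1` cannot (at `n = 1` alone
«budget + 1» HOLDS when `9 ∣ #Ш(E/K)`, `pDiv_one_iff_of_bsdp_pair`): `M_∞ = ord₃∏c_ℓ + v₃|c|` exactly,
Σ★″ asserts `M_∞ ≥` it (BSD-implied, TightData p625182) and NOTHING stronger survives on any row.
CONDITIONAL on the named facts, the two `BSDp`'s and `h56`; BSD is proved or disproved for no curve.
[cite: McCallumLMS1991, §5 Lemma 5.1, Thm. 5.4, Cor. 5.6 (pp. 303–310)] [cite: GrossZagier1986, V.(2.2)] -/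
theorem budget_succ_false_at_row_of_bsdp_pair_of_h56
    (hGZ : ∀ (N : ℕ) [NeZero N] (W : WeierstrassCurve ℚ) (K : Type) [Field K] [NumberField K],
      gross_zagier N W K)
    (hKo : ∀ (N : ℕ) [NeZero N] (W : WeierstrassCurve ℚ) (K : Type) [Field K] [NumberField K],
      kolyvagin N W K)
    (hGZK : rank_eq_analyticRank_of_analyticRank_le_one) (hmod : hasEntireLFunction_rat)
    (hGZ73 : GrossZagier1986_thm_I_7_3)
    (hrec : ∀ (N : ℕ) [NeZero N] (W : WeierstrassCurve ℚ) (K : Type) [Field K] [NumberField K],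
      heegnerPointOfConductor_one_galoisConj N W K)
    (h36 : ∀ (N : ℕ) [NeZero N] (W : WeierstrassCurve ℚ) (K : Type) [Field K] [NumberField K],
      phi_heegnerTau_mem_range_map_singularModuliField N W K)
    (W : WeierstrassCurve ℚ) [W.IsElliptic] [W.IsGloballyMinimal] (N : ℕ) [NeZero N]
    (Dt : ModularParametrizationData W N) (H : HeegnerDatum N (NumberField.discr K)) (ι : K →+* ℂ)
    (P : (W.baseChange K).toAffine.Point) (Wd : WeierstrassCurve ℚ) [Wd.IsElliptic] [Wd.IsGloballyMinimal]
    (hr : W.analyticRank = 1) (hN : W.conductorNorm ℤ = N) (h3N : 3 ∣ N)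
    (hsurj3 : W.HasSurjectiveModNGaloisRep 3) (hK : IsImaginaryQuadratic K)
    (hodd : Odd (NumberField.discr K)) (hHN : SatisfiesHeegnerHypothesis N K)
    (hLt : (W.quadraticTwist (NumberField.discr K : ℚ)).entireLFunction 1 ≠ 0)
    (hP : WeierstrassCurve.Affine.Point.map ι.toRatAlgHom P = heegnerPointComplex Dt H)
    (hC : ∃ C : VariableChange ℚ, C • W.quadraticTwist (NumberField.discr K : ℚ) = Wd)
    (hBW : BSDp W 3) (hBWd : BSDp Wd 3)
    (h56 : ∀ m : ℕ, Three.Koly.Minf Dt H.β ι 3 = m →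
      Nat.card (AddCommGroup.primaryComponent (W.baseChange K).sha 3) =
        3 ^ (2 * (padicValNat 3 (AddSubgroup.zmultiples P).index - m))) :
    ¬ (∀ (s' : ℕ), s' ≤ padicValNat 3 W.tamagawaProduct + (padicValNat 3 Dt.c.natAbs + 1) →
        ∀ (n : ℕ) (d : KolyvaginHeegnerData Dt H.β ι n), Squarefree n →
        (∀ ℓ ∈ n.primeFactors, Zhang2014.IsKolyvaginPrime N W K 3 ℓ ∧ s' ≤ Zhang2014.kolyvaginIndex W 3 ℓ) →
        Three.Koly.PDiv d 3 s') := by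
  haveI : Fact (Nat.Prime 3) := ⟨Nat.prime_three⟩
  have hp2 : (3 : ℕ) ≠ 2 := by decide
  subst hN
  intro hS
  obtain ⟨-, hμ⟩ := X11b.Three.not_dvd_discr_and_not_dvd_torsionOrder_of_heegner hK hHN hp2 h3N
  have hPinf : ¬ IsOfFinAddOrder P :=
    not_isOfFinAddOrder_of_heegner_of_analyticRank_eq_one W (W.conductorNorm ℤ) K Dt H ι P (hGZ _ W K) hmod hr hK
      hHN hLt hP
  obtain ⟨d₁⟩ := nonempty_kolyvaginHeegnerData_one_of_darmon36 (h36 _ W K) hK Dt H.β ι H.dvd_sq_sub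
  obtain ⟨hP1, hrank⟩ := map_eq_derivedPoint_and_rank_of_frame (hrec _ W K) (hKo _ W K) hK hHN hP hPinf d₁
  haveI : Finite (W.baseChange K).sha := (hKo _ W K hK hHN ⟨Dt, H, ι, hP⟩ hPinf).2
  obtain ⟨hlow, hup⟩ := WildKolyvaginUpperAtThreeTight.indexBounds_of_bsdp_of_partner_bsdp hGZ hKo hGZK hmod hGZ73
    W 3 (W.conductorNorm ℤ) K Dt H ι P Wd hr rfl h3N hK hodd hμ hHN hLt hP hC hp2 hBW hBWd
  unfold SchneiderFree.IndexLowerBoundLeAt at hlow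
  unfold SchneiderFree.Upper.IndexUpperBoundLeAt at hup
  set idx := padicValNat 3 (AddSubgroup.zmultiples P).index with hidx
  set B := padicValNat 3 W.tamagawaProduct + padicValNat 3 Dt.c.natAbs with hB
  -- the `n = 1` certificate: `3^{idx+1} ∤ P_1`, so `M_∞ ≤ idx < ∞`
  have hcert1 : ¬ Three.Koly.PDiv d₁ 3 (idx + 1) := by
    rw [pDiv_one_iff_le_padicValNat_index hK hsurj3 hrank d₁ P hP1 hPinf]
    omega
  have hMle : Three.Koly.Minf Dt H.β ι 3 ≤ idx :=
    Three.Koly.minf_le_of_certificate d₁ 3 (r := 0) ⟨squarefree_one, by simp, fun ℓ hℓ ↦ absurd hℓ (by simp)⟩ hcert1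
  obtain ⟨m, hm⟩ : ∃ m : ℕ, Three.Koly.Minf Dt H.β ι 3 = m :=
    Option.ne_none_iff_exists'.mp (by
      intro htop
      rw [htop] at hMle
      exact absurd hMle (by exact_mod_cast WithTop.not_top_le_coe idx))
  have hm_le : m ≤ idx := by rw [hm] at hMle; exact_mod_cast hMle
  -- «budget + 1» kills every certificate of level `≤ B + 1`, so `M_∞ ≥ B + 1`
  have hmB : B + 1 ≤ m := by
    by_contra hlt
    have hlt' : Three.Koly.Minf Dt H.β ι 3 < ((B + 1 : ℕ) : ℕ∞) := by
      rw [hm]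
      exact_mod_cast (by omega : m < B + 1)
    unfold Three.Koly.Minf at hlt'
    obtain ⟨r, hr'⟩ := iInf_lt_iff.mp hlt'
    unfold Three.Koly.Mr at hr'
    obtain ⟨n, hn'⟩ := iInf_lt_iff.mp hr'
    obtain ⟨d, hd'⟩ := iInf_lt_iff.mp hn'
    obtain ⟨⟨M, hdM, hmem⟩, hltM⟩ := iInf_lt_iff.mp hd'
    rw [hdM] at hltM
    have hMB : M ≤ B := by
      have : M < B + 1 := by exact_mod_cast hltM
      omega
    have hnd : ¬ Three.Koly.PDiv d 3 (M + 1) := fun h ↦ by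
      have hle : ((M + 1 : ℕ) : ℕ∞) ≤ Three.Koly.divOrd d 3 :=
        le_iSup₂ (f := fun (M' : ℕ) (_ : Three.Koly.PDiv d 3 M') ↦ (M' : ℕ∞)) (M + 1) h
      rw [hdM] at hle
      exact absurd (by exact_mod_cast hle : M + 1 ≤ M) (by omega)
    exact hnd (hS (M + 1) (by omega) n d hmem.1 fun ℓ hℓ ↦ hmem.2.2 ℓ hℓ)
  -- `h56`: `ord₃ #Ш = 2 (idx - m)`; BSD₃-pair: `2 idx = ord₃ #Ш + 2 B`
  have hsha : padicValNat 3 (W.baseChange K).shaOrder = 2 * (idx - m) := by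
    rw [Three.Koly.padicValNat_shaOrder_eq, h56 m hm, padicValNat.prime_pow]
  omega

end Sharp

/-! ## §4 The other clauses of Σ★″ (census; doc-level unless stated)

* `Odd (discr K)`, lattice-optimality `Λ_E = c·Λ_f`, the off-rows exclusion, `Addv W 3`, `SubGss W 3`:
  NOT load-bearing for TRUTH. `RamifiedPairUpperBound.pDiv_of_bsdp_of_partner_bsdp_rankOne` (p625182)
  derives `PDiv d 3 s'` for all `s' ≤ budget`, `n ∈ S(s')`, from `BSD₃(E) ∧ BSD₃(Wd)` + print for ANY
  globally minimal non-CM `W` with `3 ∣ N`, `3`-adic tower onto, `K` odd Heegner, `r_an(E) = 1`,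
  `L(E^{d_K},1) ≠ 0` — with NO optimality, NO off-rows, NO `Addv`/`SubGss` hypothesis. So dropping any of
  these keeps the statement BSD-implied on onto rows: no counterexample short of one to BSD₃. They are
  PROOF artefacts of the U-lines (Manin control at Kodaira I₀*, PUB⁺ rows, the cell decomposition).
  `Odd d_K`: also a proof artefact (`d_K ≠ -4` in the twist's Tamagawa bookkeeping); for an even Heegner
  `d_K` the two sides still transport (`Res_{K/ℚ} E ∼ E × E^{d_K}` by a `2`-power isogeny, `3`-parts
  unchanged) — reasoning, not kernel: the tree's pair bookkeeping is written for odd `d_K` only.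
* `¬ IsOfFinAddOrder P` dropped: then `r_an(E/K) ≥ 3` is allowed, `y_K` is torsion, `P_1 ∈ 3^{s'}E(K[1])`
  for all `s'` trivially (`3 ∤ #E(K[1])_tors` on onto rows), and for `n > 1` the statement asserts
  `3^{budget}`-divisibility of ALL derived points — Kolyvagin's conjecture (some `c_M(n) ≠ 0`, W. Zhang
  2014 for `p ≥ 5` good ordinary) predicts `M_∞ < ∞` but says nothing against `M_∞ ≥ budget`; open at an
  additive `3`, no witness available. Not attacked further.
* The index guard `s' ≤ kolyvaginIndex W 3 ℓ` dropped (`SigmaStarNoIndexGuard` below): see its docstring.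
* `Squarefree n` / `IsKolyvaginPrime` dropped: the derived point of a datum of non-square-free conductor or
  at a non-Kolyvagin prime obeys no Euler-system congruence tying it to `y_K`; no print, no attack.
* NO IMAGE BINDER in Σ★″ (neither `ρ̄₃` onto nor irreducible is stated) — is there a TORSION WINDOW where
  Σ★″ is false for the wrong reason? Under BSD₃ of the pair the index in the FULL group is
  `[E(K):ℤy_K] = c·u_K·∏c_q·√#Ш(E/K)` (GZ V.(2.2); torsion cancels — the tree's
  `indexBounds_of_bsdp_of_partner_bsdp` has no image hypothesis), so on a row with `E(K)[3] ≠ 0`,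
  `Ш(E/K)[3] = 0`, `h_K = 1` the `n = 1` claim `y_K ∈ 3^{T+v₃c} E(K[1])` would FAIL (`y_K = m g + t`,
  `ord₃ m = T + v₃ c − ord₃ #E(K)[3^∞] < T + v₃ c`). The window is EMPTY: `Addv W 3 ∧ SubGss W 3` makes
  `E = E₀ ⊗ χ` with `χ` quadratic ramified at `3` and `E₀/ℚ` of good SUPERSINGULAR reduction at `3`, so
  `ρ̄_{E₀,3}|I₃` is a non-split Cartan of order `8` (Serre 1972 §1.11 Prop. 12, `e = 1`), irreducible, and
  `ρ̄_{E,3} = ρ̄_{E₀,3} ⊗ χ` is irreducible too: `E(K)[3] = 0` and (Gross 4.3 / McCallum §4 (5) on the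
  irreducible cell, tree `NoTorsionIrr.torsionBy_pow_ringClassField_eq_bot_of_hasIrreducibleModPGaloisRep`)
  `E(K[n])[3^∞] = 0` for `3 ∤ n` on EVERY Σ★″ row. So the missing image binder is harmless for truth; the
  irreducible-row forms of §3 (`…_of_irreducible`) cover the 98 non-onto leaf classes. [cite: Serre1972, §1.11 Prop. 12]
-/

/-- **Σ★″ WITHOUT the index guard** (the conjunct `s' ≤ Zhang2014.kolyvaginIndex W 3 ℓ` deleted; the
prime factors of `n` are still Kolyvagin primes, so `M(ℓ) ≥ 1`). NEAR-MISS, recorded not proved.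
Expected FALSE at any onto row with budget `≥ 2` and `n = ℓ` a Kolyvagin prime of index EXACTLY `1`
(`3 ∥ ℓ + 1` or `3 ∥ a_ℓ`), `s' = 2`: the derived point `P_ℓ` is well defined only modulo
`3^{M(ℓ)} E(K[ℓ])` — another choice of the generator `σ_ℓ` or of the coset representatives `S` (both are
fields of the datum `d`, over which the statement quantifies) changes `P_ℓ` by
`s (1 + σ + ⋯ + σ^{i-1}) ((ℓ+1) y_ℓ − a_ℓ y_1) ∈ 3 E(K[ℓ])` (Gross 1991 Prop. 3.6 / (3.5)), generically NOT in
`9 E(K[ℓ])`; so `9 ∣ P_ℓ(d)` for ALL data `d` of conductor `ℓ` would force `(ℓ+1)/3 · y_ℓ − a_ℓ/3 · y_1`-type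
elements into `3 E(K[ℓ])`. OBSTRUCTION to a kernel witness: the reduction test at the prime `λ_ℓ` of
`K[ℓ]` (where `σ_ℓ` acts trivially) sees `P_ℓ ≡ (ℓ(ℓ+1)/2) · Frob y_K`, and `E(𝔽_{λ})[3^∞] ≅
ℤ/3^{v₃(ℓ+1-a_ℓ)} ⊕ ℤ/3^{v₃(ℓ+1+a_ℓ)}` contains `(ℤ/3)²` at index-`1` primes, so `9 ∣` versus `3 ∥` is
invisible there unless the two exponents differ (`9 ∣ ℓ+1+εa_ℓ`); a witness needs the explicit
`K[ℓ]`-arithmetic of one derived point (JLS 2009-type computation over a ring class field — no engine in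
this cell computes derived points, SIGMA-STATUS-g3 §4). SHARPENED (g0, for the lead): swapping one coset
representative `τ ↦ τσ_ℓ` in `S` changes `P_ℓ` by `τ(a_ℓ y(1) − (ℓ+1) y(ℓ))` (Gross (3.5) + Prop. 3.7(1)), so
the guard-free statement at `s' = 2` forces `a_ℓ y(1) − (ℓ+1) y(ℓ) ∈ 9 E(K[ℓ])`; with no `3`-torsion in
`E(K[ℓ])` (Gross 4.3) this gives `y(1) ∈ 3 E(K[1])` when `v₃(a_ℓ) = 1 < v₃(ℓ+1)` (Galois descent
`K[ℓ]/K[1]`) and `y(ℓ) ∈ 3 E(K[ℓ])` when `v₃(ℓ+1) = 1 < v₃(a_ℓ)` — PER-ROW claims that reduce to Σ★″'s own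
`n = 1` claim `3 ∣ y_K` when `h_K = 1` and are not contradicted by any trace identity when `h_K > 1`
(applying `Tr` returns `3uv·y(1) ≡ 3uv·y(1)`); hence NO structural kill: the guard is load-bearing only
modulo a per-row computation of `y(1) mod 3E(K[1])` / `y(ℓ) mod 3E(K[ℓ])`. A predicate; nothing asserted.
[cite: GrossLMS1991, Prop. 3.6 and (3.5)] [cite: McCallumLMS1991, §5 (p. 303), ord_p(P_n)]
[cite: JetchevLauterStein2009, §1] -/
def SigmaStarNoIndexGuard : Prop :=
  ∀ (W : WeierstrassCurve ℚ) [W.IsElliptic] [W.IsGloballyMinimal] (N : ℕ) [NeZero N] (K : Type) [Field K]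
    [NumberField K] (Dt : ModularParametrizationData W N) (H : HeegnerDatum N (NumberField.discr K)) (ι : K →+* ℂ)
    (P : (W.baseChange K).toAffine.Point), ¬ W.HasCM → Addv W 3 → SubGss W 3 → W.conductorNorm ℤ = N →
    (∀ z ∈ Dt.L.lattice, ∃ w ∈ periodLattice Dt.f, z = Dt.c * w) →
    ¬ ((∃ (q : ℕ) (_ : Fact q.Prime), q ∣ N ∧ ¬ q ^ 2 ∣ N ∧
          padicValNat 3 W.tamagawaProduct ≤ padicValNat 3 ((W.baseChange ℚ_[q]).localTamagawaNumber ℤ_[q])) ∧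
        (∀ (q' : ℕ) [Fact q'.Prime], q' ∣ N → 3 ∣ (W.baseChange ℚ_[q']).localTamagawaNumber ℤ_[q'] → ¬ q' ^ 2 ∣ N)) →
    IsImaginaryQuadratic K → SatisfiesHeegnerHypothesis N K →
    (WeierstrassCurve.Affine.Point.map ι.toRatAlgHom) P = heegnerPointComplex Dt H → ¬ IsOfFinAddOrder P →
    Odd (NumberField.discr K) → ∀ (s' : ℕ), s' ≤ padicValNat 3 W.tamagawaProduct + padicValNat 3 Dt.c.natAbs →
    ∀ (n : ℕ) (d : KolyvaginHeegnerData Dt H.β ι n), Squarefree n →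
    (∀ ℓ ∈ n.primeFactors, Zhang2014.IsKolyvaginPrime N W K 3 ℓ) →
    Three.Koly.PDiv d 3 s'

/-- The guard-free statement implies Σ★″ (it is a strengthening) — so a refutation of it would NOT touch
Σ★″; recorded to fix the direction. [folklore] -/
theorem leafSigmaStar_of_sigmaStarNoIndexGuard (h : SigmaStarNoIndexGuard) :
    LeafSigmaStarDivisibilityAtThreeOptimalOffRows := by
  intro W _ _ N _ K _ _ Dt H ι P hCM hAddv hGss hN hOpt hOff hK hHN hP hPinf hodd s' hs' n d hn hℓ
  exact h W N K Dt H ι P hCM hAddv hGss hN hOpt hOff hK hHN hP hPinf hodd s' hs' n d hn fun ℓ hℓn ↦ (hℓ ℓ hℓn).1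

/-! ## Targets
None served: no line is picked on 27493 and the payload carries no `targets`. The U₁ lead's stuck stub
`stub_leafSigmaStarTopLayerDivisibilityAtThreeOptimalOffSavingRows` (Σ★⁸, `Lines/splitkolyvagin.lean`
:91–:130) is Σ★″ plus the top-layer hypothesis `∀ q ∣ N prime, v₃ c_q < s'`; at `n = 1` that hypothesis
does not mention `n`, so §2 (budget load-bearing) and §3 (threshold `ord₃[E(K):ℤP]`, strengthening by
one false modulo the index hypothesis / BSD₃-pair with `3 ∤ #Ш(E/K)`) apply to Σ★⁸ verbatim on the rows
where `v₃ c_q < budget` for every `q` (the multi-carrier rows). No `stub-false`: Σ★⁸ like Σ★″ is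
BSD₃-implied on onto rows. -/

end Summit.BirchSwinnertonDyer.BirchSwinnertonDyer.Cruxes.LeafSigmaStarDivisibilityAtThreeOptimalOffRows.Disproof

end
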